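import Literature.Topology.FourManifolds.ParametricLocalDiffeo
import Mathlib.Analysis.InnerProductSpace.Calculus
import Mathlib.Analysis.Calculus.LocalExtr.Basic
import Mathlib.LinearAlgebra.FiniteDimensional.Lemmas
import Mathlib.Algebra.BigOperators.Pi
import HarnessLib

/-!
# The equivariant retraction onto the real locus, I: the implicit-function model

Topic `Topology/FourManifolds`; namespace `Literature.Topology.FourManifolds.ConjTubular`. First
file of the construction of the Arnold–Rokhlin smooth structure on the orbit space `X/σ` of an
anti-holomorphic involution (`ConjQuotientSmoothing.lean`): the smooth structure near the real
part `F = Fix σ` is built from `σ`-adapted TUBULAR charts `(a, u)` — `a` = coordinates of a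
`σ`-invariant smooth retraction `r` onto `F`, `u` = orthonormal-frame coordinates of a normal
vector — whose transition maps `(a, u) ↦ (k(a), g(a) u)`, `g(a) ∈ O(2)`, descend through the
squaring map of the normal planes (Finashin 1996 §1 ¶2; Bredon 1972 VI.2: equivariant tubular
neighbourhoods). The retraction is the nearest-point retraction, through a Whitney embedding
`e : X → ℝᴺ`, of the `σ`-average `m(y) = ½(e y + e (σ y))`.

This file is the purely Euclidean part of the proof that this retraction is smooth: everything
is read in one adapted chart, so the data are a map `ê : ℂ² → N` into a real inner product space
(the chart expression `e ∘ φ⁻¹` of the embedding; `σ` reads as `star`, the real part of `F` as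
the real vectors `ofRealVec a`, `a ∈ ℝ²`), and

* `symPart ê w = ½(ê w + ê (star w))` (the chart expression of `m`), `realSlice ê a = ê (a : ℂ²)`
  (the embedded real locus `c(a)`), `tangentVec ê a j = ∂ⱼ c (a)`;
* `critFun ê (w, a) = (⟪m̂ w − c a, ∂ⱼ c a⟫)ⱼ` — the critical-point equation of
  `a ↦ ‖m̂ w − c a‖²`, with `gramCLM ê` the Gram matrix of `(∂₁ c(0), ∂₂ c(0))`;
* `hasFDerivAt_critFun_zero`: `∂ₐ critFun (0, ·) = −Gram` at `a = 0`; `gramCLM_injective`: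
  invertible when `Dê(0)` is injective;
* `exists_implicitRetraction` — the IMPLICIT FUNCTION THEOREM (via the tree's parametric inverse
  function theorem `isLocalDiffeomorphAt_graph`): a smooth `asol` near `0` with
  `critFun (w, asol w) = 0`, unique among the zeros of `critFun` in a neighbourhood of `(0, 0)`;
* `critFun_eq_zero_of_isLocalMin` — a local minimiser `a` of `‖m̂ w − c a‖²` is a zero of
  `critFun (w, ·)`.

The manifold half (existence of minimisers on the compact real locus, identification of every
minimiser near a real point with `asol`, hence smoothness and `σ`-invariance of the retraction)
is in `ConjTubularRetraction.lean`.

## References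

* [Finashin1996] S. Finashin, J. reine angew. Math. 481 (1996) = arXiv:dg-ga/9506007, §1 ¶2.
* [Bredon1972] G. E. Bredon, *Introduction to compact transformation groups* (1972), VI.2.
* [LeeSmoothManifolds2013] J. M. Lee, *Introduction to Smooth Manifolds* (2013), Thm. C.40,
  Prop. 6.25 (tubular neighbourhoods via nearest-point retraction).
-/

noncomputable section

open scoped Manifold ContDiff Topology RealInnerProductSpace ComplexConjugate
open Set Function Filter

namespace Literature.Topology.FourManifolds

namespace ConjTubular

/-! ### Real vectors in `ℂ²` -/

/-- The inclusion of real vectors `ℝ² → ℂ²`, `a ↦ (a₀, a₁)` (continuous real-linear).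
[folklore] -/
def ofRealVec : (Fin 2 → ℝ) →L[ℝ] (Fin 2 → ℂ) :=
  ContinuousLinearMap.pi fun k ↦ Complex.ofRealCLM.comp (ContinuousLinearMap.proj k)

/-- `ofRealVec a k = a k`. [folklore] -/
@[simp] theorem ofRealVec_apply (a : Fin 2 → ℝ) (k : Fin 2) : ofRealVec a k = (a k : ℂ) := rfl

/-- Coordinatewise real part `ℂ² → ℝ²` (continuous real-linear). [folklore] -/
def reVec : (Fin 2 → ℂ) →L[ℝ] (Fin 2 → ℝ) :=
  ContinuousLinearMap.pi fun k ↦ Complex.reCLM.comp (ContinuousLinearMap.proj k)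

/-- `reVec w k = Re (w k)`. [folklore] -/
@[simp] theorem reVec_apply (w : Fin 2 → ℂ) (k : Fin 2) : reVec w k = (w k).re := rfl

/-- `Re ∘ ofReal = id`. [folklore] -/
@[simp] theorem reVec_ofRealVec (a : Fin 2 → ℝ) : reVec (ofRealVec a) = a := by
  funext k; simp

/-- Real vectors are fixed by conjugation. [folklore] -/
@[simp] theorem star_ofRealVec (a : Fin 2 → ℝ) : star (ofRealVec a) = ofRealVec a := by
  funext k; simp [Complex.conj_ofReal]

/-- A conjugation-fixed vector is the real vector of its real parts. [folklore] -/
theorem ofRealVec_reVec_of_star_eq {w : Fin 2 → ℂ} (hw : star w = w) :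
    ofRealVec (reVec w) = w := by
  funext k
  have hk : conj (w k) = w k := by simpa using congrFun hw k
  simp only [ofRealVec_apply, reVec_apply]
  exact Complex.conj_eq_iff_re.1 hk

/-- The real inclusion is injective. [folklore] -/
theorem ofRealVec_injective : Injective ofRealVec := fun a b h ↦ by
  rw [← reVec_ofRealVec a, h, reVec_ofRealVec]

/-- Decomposition of a real vector along the coordinate vectors. [folklore] -/
theorem eq_sum_single (α : Fin 2 → ℝ) : α = ∑ j, α j • (Pi.single j (1 : ℝ) : Fin 2 → ℝ) := by
  classical
  exact pi_eq_sum_univ' α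

/-! ### The chart-level objects -/

variable {N : Type*} [NormedAddCommGroup N] [InnerProductSpace ℝ N]

/-- `m̂ w = ½(ê w + ê (star w))` — chart expression of the `σ`-average `m(y) = ½(e y + e (σ y))`.
[folklore] -/
def symPart (ê : (Fin 2 → ℂ) → N) (w : Fin 2 → ℂ) : N := (2 : ℝ)⁻¹ • (ê w + ê (star w))

/-- `c(a) = ê(a)` — the embedded real locus read in the chart. [folklore] -/
def realSlice (ê : (Fin 2 → ℂ) → N) (a : Fin 2 → ℝ) : N := ê (ofRealVec a)

/-- `∂ⱼ c (a)`, the coordinate tangent vectors of the embedded real locus. [folklore] -/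
def tangentVec (ê : (Fin 2 → ℂ) → N) (a : Fin 2 → ℝ) (j : Fin 2) : N :=
  fderiv ℝ (realSlice ê) a (Pi.single j 1)

/-- The critical-point map `Ψ̂(w, a) = (⟪m̂ w − c a, ∂ⱼ c a⟫)ⱼ`: `a ↦ ‖m̂ w − c a‖²` is
critical at `a` iff `Ψ̂(w, a) = 0`. [folklore] -/
def critFun (ê : (Fin 2 → ℂ) → N) (wa : (Fin 2 → ℂ) × (Fin 2 → ℝ)) : Fin 2 → ℝ :=
  fun j ↦ ⟪symPart ê wa.1 - realSlice ê wa.2, tangentVec ê wa.2 j⟫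

/-- The Gram map of the frame `(∂₁ c(0), ∂₂ c(0))`: `α ↦ (⟪∂ⱼ c(0), Dc(0) α⟫)ⱼ`. [folklore] -/
def gramCLM (ê : (Fin 2 → ℂ) → N) : (Fin 2 → ℝ) →L[ℝ] (Fin 2 → ℝ) :=
  ContinuousLinearMap.pi fun j ↦ (innerSL ℝ (tangentVec ê 0 j)).comp (fderiv ℝ (realSlice ê) 0)

/-- Coordinates of the Gram map. [folklore] -/
@[simp] theorem gramCLM_apply (ê : (Fin 2 → ℂ) → N) (α : Fin 2 → ℝ) (j : Fin 2) :
    gramCLM ê α j = ⟪tangentVec ê 0 j, fderiv ℝ (realSlice ê) 0 α⟫ := rfl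

variable {ê : (Fin 2 → ℂ) → N} {T : Set (Fin 2 → ℂ)}

/-- `m̂` is even under `star`. [folklore] -/
theorem symPart_star (ê : (Fin 2 → ℂ) → N) (w : Fin 2 → ℂ) :
    symPart ê (star w) = symPart ê w := by
  simp [symPart, add_comm]

/-- On real vectors `m̂ = c`. [folklore] -/
theorem symPart_ofRealVec (ê : (Fin 2 → ℂ) → N) (a : Fin 2 → ℝ) :
    symPart ê (ofRealVec a) = realSlice ê a := by
  simp only [symPart, star_ofRealVec, realSlice, ← two_smul ℝ, smul_smul]
  norm_num

/-- `Ψ̂(a, a) = 0`: a real point is critical for itself. [folklore] -/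
theorem critFun_ofRealVec_self (ê : (Fin 2 → ℂ) → N) (a : Fin 2 → ℝ) :
    critFun ê (ofRealVec a, a) = 0 := by
  funext j
  simp [critFun, symPart_ofRealVec]

/-- `Ψ̂` is even under `star` in the first variable. [folklore] -/
theorem critFun_star (ê : (Fin 2 → ℂ) → N) (w : Fin 2 → ℂ) (a : Fin 2 → ℝ) :
    critFun ê (star w, a) = critFun ê (w, a) := by
  funext j
  simp [critFun, symPart_star]

/-! ### Smoothness -/

/-- The set of real parameters whose real vector lies in `T` is open. [folklore] -/
theorem isOpen_preimage_ofRealVec (hT : IsOpen T) : IsOpen (ofRealVec ⁻¹' T) :=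
  hT.preimage ofRealVec.continuous

/-- `c` is `C^∞` where `ê` is. [folklore] -/
theorem contDiffOn_realSlice (hê : ContDiffOn ℝ ∞ ê T) :
    ContDiffOn ℝ ∞ (realSlice ê) (ofRealVec ⁻¹' T) :=
  hê.comp ofRealVec.contDiff.contDiffOn fun _ ha ↦ ha

/-- `∂ⱼ c` is `C^∞` where `ê` is. [folklore] -/
theorem contDiffOn_tangentVec (hT : IsOpen T) (hê : ContDiffOn ℝ ∞ ê T) (j : Fin 2) :
    ContDiffOn ℝ ∞ (fun a ↦ tangentVec ê a j) (ofRealVec ⁻¹' T) := by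
  have h := (contDiffOn_realSlice hê).fderiv_of_isOpen (isOpen_preimage_ofRealVec hT)
    (m := ∞) (by simp)
  exact h.clm_apply contDiffOn_const

/-- `m̂` is `C^∞` on `T` when `T` is `star`-invariant. [folklore] -/
theorem contDiffOn_symPart (hê : ContDiffOn ℝ ∞ ê T) (hTs : ∀ w ∈ T, star w ∈ T) :
    ContDiffOn ℝ ∞ (symPart ê) T := by
  have hstar : ContDiff ℝ ∞ (star : (Fin 2 → ℂ) → (Fin 2 → ℂ)) :=
    (starL' ℝ (A := Fin 2 → ℂ) : (Fin 2 → ℂ) ≃L[ℝ] (Fin 2 → ℂ)).contDiff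
  exact ((hê.add (hê.comp hstar.contDiffOn fun w hw ↦ hTs w hw)).const_smul _)

/-- `Ψ̂` is `C^∞` on `T × (real parameters in T)`. [folklore] -/
theorem contDiffOn_critFun (hT : IsOpen T) (hê : ContDiffOn ℝ ∞ ê T)
    (hTs : ∀ w ∈ T, star w ∈ T) :
    ContDiffOn ℝ ∞ (critFun ê) (T ×ˢ (ofRealVec ⁻¹' T)) := by
  rw [contDiffOn_pi]
  intro j
  refine ContDiffOn.inner (𝕜 := ℝ) ?_ ?_
  · exact ((contDiffOn_symPart hê hTs).comp contDiffOn_fst fun _ h ↦ h.1).sub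
      ((contDiffOn_realSlice hê).comp contDiffOn_snd fun _ h ↦ h.2)
  · exact (contDiffOn_tangentVec hT hê j).comp contDiffOn_snd fun _ h ↦ h.2

/-! ### The partial derivative in `a` at the origin and its invertibility -/

/-- **`∂ₐ Ψ̂(0, ·)(0) = −Gram`**: at a real point the derivative of the critical-point map in
the unknown is minus the Gram matrix of the tangent frame of the real locus. [folklore] -/
theorem hasFDerivAt_critFun_zero (hT : IsOpen T) (h0 : (0 : Fin 2 → ℂ) ∈ T)
    (hê : ContDiffOn ℝ ∞ ê T) :
    HasFDerivAt (fun a ↦ critFun ê (0, a)) (-gramCLM ê) 0 := by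
  have hA : IsOpen (ofRealVec ⁻¹' T) := isOpen_preimage_ofRealVec hT
  have h0A : (0 : Fin 2 → ℝ) ∈ ofRealVec ⁻¹' T := by simpa using h0
  have hc : HasFDerivAt (realSlice ê) (fderiv ℝ (realSlice ê) 0) 0 :=
    (((contDiffOn_realSlice hê).differentiableOn (by simp)).differentiableAt
      (hA.mem_nhds h0A)).hasFDerivAt
  have ht : ∀ j, HasFDerivAt (fun a ↦ tangentVec ê a j)
      (fderiv ℝ (fun a ↦ tangentVec ê a j) 0) 0 := fun j ↦
    (((contDiffOn_tangentVec hT hê j).differentiableOn (by simp)).differentiableAt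
      (hA.mem_nhds h0A)).hasFDerivAt
  have hm0 : symPart ê 0 = realSlice ê 0 := by
    have := symPart_ofRealVec ê 0
    simpa using this
  refine hasFDerivAt_pi'.2 fun j ↦ ?_
  show HasFDerivAt (fun a ↦ ⟪symPart ê 0 - realSlice ê a, tangentVec ê a j⟫) _ 0
  have h := ((hasFDerivAt_const (symPart ê 0) 0).sub hc).inner ℝ (ht j)
  refine h.congr_fderiv ?_
  ext α
  simp [fderivInnerCLM_apply, hm0, real_inner_comm]

/-- `Dc(0) α = Σ αⱼ ∂ⱼ c(0)`. [folklore] -/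
theorem fderiv_realSlice_eq_sum (α : Fin 2 → ℝ) :
    fderiv ℝ (realSlice ê) 0 α = ∑ j, α j • tangentVec ê 0 j := by
  conv_lhs => rw [eq_sum_single α]
  simp [map_smul, tangentVec]

/-- **The Gram map is injective** when `Dê(0)` is: `⟪Dc α, Dc α⟫ = Σ αⱼ (Gram α)ⱼ`. [folklore] -/
theorem gramCLM_injective (hT : IsOpen T) (h0 : (0 : Fin 2 → ℂ) ∈ T)
    (hê : ContDiffOn ℝ ∞ ê T) (hinj : Injective (fderiv ℝ ê 0)) :
    Injective (gramCLM ê) := by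
  have hA : IsOpen (ofRealVec ⁻¹' T) := isOpen_preimage_ofRealVec hT
  -- `Dc(0) = Dê(0) ∘ ofRealVec`
  have hchain : fderiv ℝ (realSlice ê) 0 = (fderiv ℝ ê 0).comp ofRealVec := by
    have h0' : ofRealVec (0 : Fin 2 → ℝ) = 0 := map_zero _
    have hd : DifferentiableAt ℝ ê (ofRealVec 0) := by
      rw [h0']
      exact (hê.differentiableOn (by simp)).differentiableAt (hT.mem_nhds h0)
    have hrs : realSlice ê = ê ∘ ofRealVec := rfl
    rw [hrs, fderiv_comp 0 hd ofRealVec.differentiableAt, ofRealVec.fderiv, h0']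
  refine (injective_iff_map_eq_zero _).2 fun α hα ↦ ?_
  have hzero : ⟪fderiv ℝ (realSlice ê) 0 α, fderiv ℝ (realSlice ê) 0 α⟫ = 0 := by
    have h1 : ⟪∑ j, α j • tangentVec ê 0 j, fderiv ℝ (realSlice ê) 0 α⟫ = 0 := by
      rw [sum_inner]
      refine Finset.sum_eq_zero fun j _ ↦ ?_
      rw [real_inner_smul_left, ← gramCLM_apply, hα, Pi.zero_apply, mul_zero]
    rwa [← fderiv_realSlice_eq_sum] at h1
  have h1 : fderiv ℝ (realSlice ê) 0 α = 0 := inner_self_eq_zero.1 hzero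
  rw [hchain] at h1
  exact ofRealVec_injective (hinj (by simpa using h1))

/-- The Gram map as a continuous linear equivalence (negated, to match `∂ₐ Ψ̂`). [folklore] -/
theorem exists_gramEquiv (hT : IsOpen T) (h0 : (0 : Fin 2 → ℂ) ∈ T)
    (hê : ContDiffOn ℝ ∞ ê T) (hinj : Injective (fderiv ℝ ê 0)) :
    ∃ B : (Fin 2 → ℝ) ≃L[ℝ] (Fin 2 → ℝ), (B : (Fin 2 → ℝ) →L[ℝ] (Fin 2 → ℝ)) = -gramCLM ê := by
  have hinj' : Injective ((-gramCLM ê : (Fin 2 → ℝ) →L[ℝ] (Fin 2 → ℝ)) :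
      (Fin 2 → ℝ) →ₗ[ℝ] (Fin 2 → ℝ)) := by
    intro a b h
    apply gramCLM_injective hT h0 hê hinj
    have : -gramCLM ê a = -gramCLM ê b := h
    exact neg_injective this
  refine ⟨(LinearMap.linearEquivOfInjective _ hinj' rfl).toContinuousLinearEquiv, ?_⟩
  ext a j
  rfl

/-! ### The implicit function -/

/-- **The implicit retraction (model).** If `ê : ℂ² → N` is `C^∞` on an open `star`-invariant
set `T ∋ 0` with `Dê(0)` injective, there are an open `W₀ ∋ 0` in `ℂ²`, an open `U ∋ (0, 0)`
in `ℂ² × ℝ²` and a `C^∞` map `asol : ℂ² → ℝ²` on `W₀` with `asol 0 = 0`, `(w, asol w) ∈ U` and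
`Ψ̂(w, asol w) = 0` for `w ∈ W₀`, and UNIQUENESS: a zero `(w, a) ∈ U` of `Ψ̂` with `w ∈ W₀`
has `a = asol w`. (Implicit function theorem for `Ψ̂(w, a) = 0` at `(0, 0)`, from the
parametric inverse function theorem applied to `(w, a) ↦ (w, Ψ̂(w, a))`.)
[cite: LeeSmoothManifolds2013, Thm. C.40] -/
theorem exists_implicitRetraction (hT : IsOpen T) (hTs : ∀ w ∈ T, star w ∈ T)
    (h0 : (0 : Fin 2 → ℂ) ∈ T) (hê : ContDiffOn ℝ ∞ ê T) (hinj : Injective (fderiv ℝ ê 0)) :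
    ∃ (asol : (Fin 2 → ℂ) → (Fin 2 → ℝ)) (W₀ : Set (Fin 2 → ℂ))
      (U : Set ((Fin 2 → ℂ) × (Fin 2 → ℝ))),
      IsOpen W₀ ∧ (0 : Fin 2 → ℂ) ∈ W₀ ∧ W₀ ⊆ T ∧ IsOpen U ∧ ContDiffOn ℝ ∞ asol W₀ ∧
      asol 0 = 0 ∧ (∀ w ∈ W₀, (w, asol w) ∈ U ∧ critFun ê (w, asol w) = 0) ∧
      ∀ wa ∈ U, critFun ê wa = 0 → wa.1 ∈ W₀ → wa.2 = asol wa.1 := by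
  have hA : IsOpen (ofRealVec ⁻¹' T) := isOpen_preimage_ofRealVec hT
  have h0A : (0 : Fin 2 → ℝ) ∈ ofRealVec ⁻¹' T := by simpa using h0
  obtain ⟨B, hB⟩ := exists_gramEquiv hT h0 hê hinj
  have hq : ((0 : Fin 2 → ℂ), (0 : Fin 2 → ℝ)) ∈ T ×ˢ (ofRealVec ⁻¹' T) := ⟨h0, h0A⟩
  have hloc := isLocalDiffeomorphAt_graph (hT.prod hA) hq (contDiffOn_critFun hT hê hTs)
    (n := ∞) (by simp) B (by rw [hB]; exact hasFDerivAt_critFun_zero hT h0 hê)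
  obtain ⟨Γ, h0Γ, hΓ⟩ := hloc
  -- notation
  set G : (Fin 2 → ℂ) × (Fin 2 → ℝ) → (Fin 2 → ℂ) × (Fin 2 → ℝ) :=
    fun q ↦ (q.1, critFun ê q) with hG
  have hG00 : G (0, 0) = (0, 0) := by
    simp only [hG, Prod.mk.injEq, true_and]
    simpa using critFun_ofRealVec_self ê 0
  have hΓG : ∀ q ∈ Γ.source, Γ q = G q := fun q hq ↦ (hΓ hq).symm
  have htgt0 : ((0 : Fin 2 → ℂ), (0 : Fin 2 → ℝ)) ∈ Γ.target := by
    have := Γ.map_source h0Γ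
    rwa [show Γ.toPartialEquiv (0, 0) = Γ (0, 0) from rfl, hΓG _ h0Γ, hG00] at this
  -- the implicit function
  set asol : (Fin 2 → ℂ) → (Fin 2 → ℝ) := fun w ↦ (Γ.symm (w, 0)).2 with hasol
  set W₀ : Set (Fin 2 → ℂ) := {w | (w, (0 : Fin 2 → ℝ)) ∈ Γ.target} ∩ T with hW₀
  have hW₀o : IsOpen W₀ :=
    (Γ.open_target.preimage (Continuous.prodMk_left 0)).inter hT
  have hkey : ∀ w, (w, (0 : Fin 2 → ℝ)) ∈ Γ.target →
      Γ.symm (w, 0) ∈ Γ.source ∧ Γ.symm (w, 0) = (w, asol w) ∧ critFun ê (w, asol w) = 0 := by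
    intro w hw
    have hsrc : Γ.symm (w, 0) ∈ Γ.source := Γ.map_target hw
    have hGq : G (Γ.symm (w, 0)) = (w, 0) := by
      rw [← hΓG _ hsrc]
      exact Γ.right_inv hw
    have h1 : (Γ.symm (w, 0)).1 = w := by
      have := congrArg Prod.fst hGq
      simpa [hG] using this
    have heq : Γ.symm (w, 0) = (w, asol w) := Prod.ext h1 rfl
    refine ⟨hsrc, heq, ?_⟩
    have := congrArg Prod.snd hGq
    rw [heq] at this
    simpa [hG] using this
  refine ⟨asol, W₀, Γ.source, hW₀o, ⟨htgt0, h0⟩, inter_subset_right, Γ.open_source, ?_, ?_,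
    fun w hw ↦ ?_, ?_⟩
  · -- smoothness: `asol = snd ∘ Γ.symm ∘ (·, 0)`
    have hsymm : ContDiffOn ℝ ∞ Γ.symm Γ.target :=
      contMDiffOn_iff_contDiffOn.1 Γ.contMDiffOn_invFun
    have h1 : ContDiffOn ℝ ∞ (fun w : Fin 2 → ℂ ↦ (w, (0 : Fin 2 → ℝ))) W₀ :=
      (contDiffOn_id.prodMk contDiffOn_const)
    exact contDiffOn_snd.comp (hsymm.comp h1 fun w hw ↦ hw.1) (mapsTo_univ _ _)
  · -- `asol 0 = 0`
    have : Γ.toPartialEquiv.symm (0, 0) = (0, 0) := by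
      have h := Γ.left_inv h0Γ
      rwa [show Γ.toPartialEquiv (0, 0) = Γ (0, 0) from rfl, hΓG _ h0Γ, hG00] at h
    show (Γ.toPartialEquiv.symm (0, 0)).2 = 0
    rw [this]
  · obtain ⟨hsrc, heq, hzero⟩ := hkey w hw.1
    exact ⟨heq ▸ hsrc, hzero⟩
  · rintro ⟨w, a⟩ hwa hz hw
    obtain ⟨hsrc, heq, -⟩ := hkey w hw.1
    have h1 : G (w, a) = (w, 0) := by simp [hG, hz]
    have h2 : G (w, asol w) = (w, 0) := by
      have := Γ.right_inv hw.1
      rw [show Γ.toPartialEquiv.symm (w, 0) = Γ.symm (w, 0) from rfl, heq,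
        show Γ.toPartialEquiv (w, asol w) = Γ (w, asol w) from rfl, hΓG _ (heq ▸ hsrc)] at this
      exact this
    have hinjΓ : (w, a) = (w, asol w) := by
      apply Γ.injOn hwa (heq ▸ hsrc)
      rw [show Γ.toPartialEquiv (w, a) = Γ (w, a) from rfl, hΓG _ hwa, h1,
        show Γ.toPartialEquiv (w, asol w) = Γ (w, asol w) from rfl, hΓG _ (heq ▸ hsrc), h2]
    simpa using congrArg Prod.snd hinjΓ

/-- **Minimisers are critical**: if `a` is a local minimiser of `a ↦ ‖m̂ w − c a‖²` at an
interior parameter, then `Ψ̂(w, a) = 0` (first-order condition). [folklore] -/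
theorem critFun_eq_zero_of_isLocalMin (hT : IsOpen T) (hê : ContDiffOn ℝ ∞ ê T)
    {w : Fin 2 → ℂ} {a : Fin 2 → ℝ} (ha : ofRealVec a ∈ T)
    (hmin : IsLocalMin (fun b ↦ ‖symPart ê w - realSlice ê b‖ ^ 2) a) :
    critFun ê (w, a) = 0 := by
  have hA : IsOpen (ofRealVec ⁻¹' T) := isOpen_preimage_ofRealVec hT
  have hc : HasFDerivAt (realSlice ê) (fderiv ℝ (realSlice ê) a) a :=
    (((contDiffOn_realSlice hê).differentiableOn (by simp)).differentiableAt
      (hA.mem_nhds ha)).hasFDerivAt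
  have hd := ((hasFDerivAt_const (symPart ê w) a).sub hc).norm_sq
  have hzero := hmin.hasFDerivAt_eq_zero hd
  funext j
  have := congrArg (fun L : (Fin 2 → ℝ) →L[ℝ] ℝ ↦ L (Pi.single j 1)) hzero
  simp at this
  simp only [critFun, tangentVec, Pi.zero_apply]
  rw [inner_sub_left]
  linarith

end ConjTubular

end Literature.Topology.FourManifolds

end
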